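import Summits.QuantumAdvantage.QuantumAdvantage.Theorems.WalkThreeStepSymmetry

/-!
# Rung (G♯₂) `ThreeStepFreeRungFive` (item stmt-QuantumAdvantage-23286), architecture (U): DEGENERACY ⇒ SYMMETRY WITHOUT LOCALITY

Cell qa-qnc0, route OddPrimeWalk, support item stmt-QuantumAdvantage-23286; prover qn-prover-3 g16.

Strengthening of `reg_cornerFlip` (U-d 3/5): the locality hypothesis `LocalOrBlind` is NOT needed for the symmetry step.  If position
`k` is `Degenerate` and every cut observing `k` (the own cut and the `coSplit S k` cuts with a split at `k`; their positions and reads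
are otherwise arbitrary) is positioned below some `z₀` with room `z₀ + (2·coSplit + 4)(2p − 1) ≤ n` for far zones, then the
transposition at `k` fixes the F₄ register of EVERY input: **`reg_cornerFlip_free`**.
Reason: the register differential `D_k(x)` only involves the observers of `k` (a fixed set of ≤ coSplit + 1 three-step cuts); a zone
flip to the right of all their POSITIONS that keeps the residues `mod p` of all their READS (a zone is spoiled only by a read strictly
inside it: `exists_two_clean_of_finset`, pigeonhole) leaves `D_k` unchanged (`diff_congr_far`) and moves `W` by `±p`; two such zones and
degeneracy give the four vanishing traces, hence `D_k = 0`.  In the assembly of (U) this removes (H1) from the symmetry step: on a hub-free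
degenerate interval away from the reads of the end-positioned cuts, `Ŵ` is a symmetric function of the interval's bits unconditionally.
WHAT THIS IS NOT: the increment step of the three-weights law still uses locality; separation NOT moved.
-/

namespace Summit.QuantumAdvantage.AdviceFreeQNC0.LocalEngine

open Finset Classical

namespace RungU

variable {p n : ℕ}

/-! ### §1 Two clean zones among `#reads + 2` -/

/-- a point lies strictly inside at most one of the disjoint zones `[z₀ + j m, z₀ + j m + m)`. -/
theorem zone_unique {z₀ m r j j' : ℕ} (h1 : z₀ + j * m < r ∧ r < z₀ + j * m + m) (h2 : z₀ + j' * m < r ∧ r < z₀ + j' * m + m) :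
    j = j' := by
  have a : j * m < (j' + 1) * m := by nlinarith
  have b : j' * m < (j + 1) * m := by nlinarith
  have a' := Nat.lt_of_mul_lt_mul_right a
  have b' := Nat.lt_of_mul_lt_mul_right b
  omega

/-- **pigeonhole**: among `#Rd + 2` consecutive disjoint zones two avoid every point of `Rd` in their interior. -/
theorem exists_two_clean_of_finset (z₀ m : ℕ) (Rd : Finset ℕ) :
    ∃ j₁ j₂ : ℕ, j₁ < j₂ ∧ j₂ < Rd.card + 2 ∧
      (∀ r ∈ Rd, ¬ (z₀ + j₁ * m < r ∧ r < z₀ + j₁ * m + m)) ∧ (∀ r ∈ Rd, ¬ (z₀ + j₂ * m < r ∧ r < z₀ + j₂ * m + m)) := by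
  set spoiled : Finset ℕ := (range (Rd.card + 2)).filter fun j => ∃ r ∈ Rd, z₀ + j * m < r ∧ r < z₀ + j * m + m with hsp
  set clean : Finset ℕ := (range (Rd.card + 2)).filter fun j => ¬ ∃ r ∈ Rd, z₀ + j * m < r ∧ r < z₀ + j * m + m with hcl
  -- spoiled zones inject into Rd
  have hle : spoiled.card ≤ Rd.card := by
    let w : ℕ → ℕ := fun j => if h : ∃ r ∈ Rd, z₀ + j * m < r ∧ r < z₀ + j * m + m then Classical.choose h else 0
    have hw : ∀ j ∈ spoiled, w j ∈ Rd ∧ z₀ + j * m < w j ∧ w j < z₀ + j * m + m := by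
      intro j hj
      rw [hsp, Finset.mem_filter] at hj
      have hs := Classical.choose_spec hj.2
      simp only [w, dif_pos hj.2]
      exact ⟨hs.1, hs.2⟩
    apply Finset.card_le_card_of_injOn w (fun j hj => (hw j hj).1)
    intro j hj j' hj' he
    have a := hw j hj
    have b := hw j' hj'
    rw [he] at a
    exact zone_unique a.2 b.2
  have hsplit := Finset.card_filter_add_card_filter_not (s := range (Rd.card + 2))
    (fun j => ∃ r ∈ Rd, z₀ + j * m < r ∧ r < z₀ + j * m + m)
  rw [Finset.card_range] at hsplit
  have hcl2 : 1 < clean.card := by rw [hcl]; rw [hsp] at hle; omega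
  obtain ⟨a, ha, b, hb, hab⟩ := Finset.one_lt_card.mp hcl2
  rw [hcl, Finset.mem_filter, Finset.mem_range] at ha hb
  rcases Nat.lt_or_gt_of_ne hab with h | h
  · exact ⟨a, b, h, hb.1, fun r hr hh => ha.2 ⟨r, hr, hh⟩, fun r hr hh => hb.2 ⟨r, hr, hh⟩⟩
  · exact ⟨b, a, h, ha.1, fun r hr hh => hb.2 ⟨r, hr, hh⟩, fun r hr hh => ha.2 ⟨r, hr, hh⟩⟩

/-! ### §2 The differential is local to the observers -/

/-- the reads of the observers of `k` (own cut included). -/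
noncomputable def obsReads (S : ThreeStep p n) (k : ℕ) : Finset ℕ :=
  (obs S k).biUnion fun g => {S.s g, max (S.s g) (S.t g)}

/-- an observer's two reads are in `obsReads`. -/
theorem mem_obsReads (S : ThreeStep p n) (k : ℕ) {g : Fin (n + 1)} (hg : Observes S g k) :
    S.s g ∈ obsReads S k ∧ max (S.s g) (S.t g) ∈ obsReads S k := by
  unfold obsReads
  constructor <;> rw [Finset.mem_biUnion] <;> refine ⟨g, ?_, by simp⟩ <;> (unfold obs; rw [Finset.mem_filter]; exact ⟨mem_univ _, hg⟩)

/-- `#obsReads ≤ 2·coSplit + 2`. -/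
theorem card_obsReads_le (S : ThreeStep p n) (k : ℕ) : (obsReads S k).card ≤ 2 * coSplit S k + 2 := by
  unfold obsReads
  have h := Finset.card_biUnion_le_card_mul (obs S k) (fun g => ({S.s g, max (S.s g) (S.t g)} : Finset ℕ)) 2
    (fun g _ => Finset.card_le_two)
  have h2 := card_obs_le S k
  nlinarith

/-- **Invariance of the differential, no locality**: if `x'` agrees with `x` below `z`, every observer of `k` is positioned below `z`,
`k < z`, the weights agree `mod p` and every read of an observer keeps its residue `mod p`, then `D_k(x') = D_k(x)`. -/
theorem diff_congr_far (S : ThreeStep p n) {k z : ℕ} (hk1 : 1 ≤ k) (hkn : k < n) (hkz : k < z)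
    (hobs : ∀ g : Fin (n + 1), Observes S g k → g.val < z) {x x' : Fin n → Bool}
    (hag : ∀ i : Fin n, i.val < z → x' i = x i) (hwt : wt x' % p = wt x % p)
    (hreads : ∀ r ∈ obsReads S k, wtPrefix x' r % p = wtPrefix x r % p) :
    diff S k x' = diff S k x := by
  unfold diff reg
  rw [← Finset.sum_add_distrib, ← Finset.sum_add_distrib]
  apply Finset.sum_congr rfl
  intro g _
  have hagσ : ∀ i : Fin n, i.val < z → cornerFlip n k x' i = cornerFlip n k x i := by
    intro i hi
    by_cases h1 : i.val + 1 = k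
    · have e : i = ⟨k - 1, by omega⟩ := Fin.ext (by simp; omega)
      rw [e, cornerFlip_apply_left k x' (by omega) hkn, cornerFlip_apply_left k x (by omega) hkn]
      exact hag _ (by simp; omega)
    · by_cases h2 : i.val = k
      · have e : i = ⟨k, hkn⟩ := Fin.ext (by simpa using h2)
        rw [e, cornerFlip_apply_right k x' (by omega) hkn, cornerFlip_apply_right k x (by omega) hkn]
        exact hag _ (by simp; omega)
      · rw [DensePeel.cornerFlip_apply_of_ne k x' i h1 h2, DensePeel.cornerFlip_apply_of_ne k x i h1 h2]
        exact hag i hi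
  have hNb : ∀ r, r ≤ z → wtPrefix x' r = wtPrefix x r := fun r hr =>
    DensePeel.wtPrefix_congr_below x' x r fun i hi => hag i (by omega)
  have hNbσ : ∀ r, r ≤ z → wtPrefix (cornerFlip n k x') r = wtPrefix (cornerFlip n k x) r := fun r hr =>
    DensePeel.wtPrefix_congr_below _ _ r fun i hi => hagσ i (by omega)
  -- residues of the flipped inputs at any read r
  have hσres : ∀ r, wtPrefix x' r % p = wtPrefix x r % p →
      wtPrefix (cornerFlip n k x') r % p = wtPrefix (cornerFlip n k x) r % p := by
    intro r hr
    by_cases hrk : r = k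
    · rw [hrk, hNbσ k (by omega)]
    · rw [wtPrefix_cornerFlip k x' hrk, wtPrefix_cornerFlip k x hrk]; exact hr
  by_cases ho : Observes S g k
  · obtain ⟨m1, m2⟩ := mem_obsReads S k ho
    have hJ : S.y g x' = S.y g x := y_congr_of_mod S g (hreads _ m1) (hreads _ m2) hwt
    have hJσ : S.y g (cornerFlip n k x') = S.y g (cornerFlip n k x) :=
      y_congr_of_mod S g (hσres _ (hreads _ m1)) (hσres _ (hreads _ m2)) (by rw [wt_cornerFlip, wt_cornerFlip]; exact hwt)
    have hgz := hobs g ho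
    rw [term_congr S g hJ (hNb g.val (by omega)), term_congr S g hJσ (hNbσ g.val (by omega))]
  · -- non-observer: its two terms cancel on both sides
    have hno : g.val ≠ k ∧ S.s g ≠ k ∧ S.t g ≠ k := by
      unfold Observes at ho; push Not at ho; exact ho
    have h1 : term S (cornerFlip n k x') g = term S x' g :=
      term_congr S g (ThreeStep.y_cornerFlip S k x' g hno.2.1 hno.2.2) (wtPrefix_cornerFlip k x' hno.1)
    have h2 : term S (cornerFlip n k x) g = term S x g :=
      term_congr S g (ThreeStep.y_cornerFlip S k x g hno.2.1 hno.2.2) (wtPrefix_cornerFlip k x hno.1)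
    rw [h1, h2, F4_add_self, F4_add_self]

/-! ### §3 Degeneracy ⇒ symmetry, unconditionally -/

/-- **DEGENERACY ⇒ SYMMETRY WITHOUT LOCALITY.** `k` degenerate, all observers of `k` positioned below `z₀ > k`, and room for
`2·coSplit + 4` far zones of `2p − 1` bits: the transposition at `k` fixes the register of every input (`3 ∤ p`). -/
theorem reg_cornerFlip_free (hp : 1 ≤ p) (hp3 : p % 3 ≠ 0) (c : ℕ) (S : ThreeStep p n) {k z₀ : ℕ}
    (hk1 : 1 ≤ k) (hkz : k < z₀) (hdeg : Degenerate c S k) (hobs : ∀ g : Fin (n + 1), Observes S g k → g.val < z₀)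
    (hroom : z₀ + (2 * coSplit S k + 4) * (2 * p - 1) ≤ n) (x : Fin n → Bool) :
    reg S (cornerFlip n k x) = reg S x := by
  have hkn : k < n := by
    have : 1 ≤ 2 * p - 1 := by omega
    nlinarith
  set m := 2 * p - 1 with hm
  have hm1 : 1 ≤ m := by omega
  -- two clean zones
  obtain ⟨j₁, j₂, hj12, hj2, c1, c2⟩ := exists_two_clean_of_finset z₀ m (obsReads S k)
  have hRd := card_obsReads_le S k
  have hj2' : j₂ + 1 ≤ 2 * coSplit S k + 4 := by omega
  have hzone2 : z₀ + j₂ * m + m ≤ n := by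
    have : (j₂ + 1) * m ≤ (2 * coSplit S k + 4) * m := Nat.mul_le_mul_right m hj2'
    nlinarith
  have hzone1 : z₀ + j₁ * m + m ≤ n := by
    have : j₁ * m ≤ j₂ * m := Nat.mul_le_mul_right m hj12.le
    omega
  obtain ⟨F₁, hF₁⟩ := exists_zoneFlip hp x (z₀ + j₁ * m) (by rw [← hm]; exact hzone1)
  obtain ⟨F₂, hF₂⟩ := exists_zoneFlip hp (flipOn F₁ x) (z₀ + j₂ * m) (by rw [← hm]; exact hzone2)
  have hsep : z₀ + j₁ * m + m ≤ z₀ + j₂ * m := by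
    have : (j₁ + 1) * m ≤ j₂ * m := Nat.mul_le_mul_right m hj12
    nlinarith
  have hF₂' : ZoneFlip p x F₂ (z₀ + j₂ * m) (2 * p - 1) := by
    refine ⟨hF₂.card_eq, hF₂.inside, ?_⟩
    have e : ∀ i ∈ F₂, flipOn F₁ x i = x i := by
      intro i hi
      apply flipOn_of_not_mem
      intro hi1
      have a1 := (hF₁.inside i hi1).2
      have a2 := (hF₂.inside i hi).1
      omega
    rcases hF₂.const with h | h
    · left; intro i hi; rw [← e i hi]; exact h i hi
    · right; intro i hi; rw [← e i hi]; exact h i hi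
  -- invariance of the differential under the flips
  have hD : ∀ {y : Fin n → Bool} {F : Finset (Fin n)} {zz : ℕ}, ZoneFlip p y F zz (2 * p - 1) → z₀ ≤ zz → zz + (2 * p - 1) ≤ n →
      (∀ r ∈ obsReads S k, ¬ (zz < r ∧ r < zz + (2 * p - 1))) → diff S k (flipOn F y) = diff S k y := by
    intro y F zz hF hzz hzn hcl
    exact diff_congr_far S hk1 hkn hkz hobs (fun i hi => hF.apply_of_lt (by omega)) (hF.wt_mod_eq hzn)
      (fun r hr => hF.wtPrefix_mod_eq (hcl r hr))
  have d1 : diff S k (flipOn F₁ x) = diff S k x :=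
    hD hF₁ (by omega) (by rw [← hm]; exact hzone1) (by rw [← hm]; exact c1)
  have d2 : diff S k (flipOn F₂ x) = diff S k x :=
    hD hF₂' (by omega) (by rw [← hm]; exact hzone2) (by rw [← hm]; exact c2)
  have d12 : diff S k (flipOn F₂ (flipOn F₁ x)) = diff S k x := by
    rw [hD hF₂ (by omega) (by rw [← hm]; exact hzone2) (by rw [← hm]; exact c2), d1]
  -- the four traces vanish by degeneracy at k
  have t0 := evZ_diff_of_degenerate c S k hdeg x
  have t1 := evZ_diff_of_degenerate c S k hdeg (flipOn F₁ x)
  have t2 := evZ_diff_of_degenerate c S k hdeg (flipOn F₂ x)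
  have t12 := evZ_diff_of_degenerate c S k hdeg (flipOn F₂ (flipOn F₁ x))
  rw [d1] at t1
  rw [d2] at t2
  rw [d12] at t12
  have hpz := cast_p_ne_zero hp3
  obtain ⟨s₁, hs₁, w1⟩ : ∃ s₁ : ZMod 3, s₁ ≠ 0 ∧ ((wt (flipOn F₁ x) : ℕ) : ZMod 3) = (wt x : ℕ) + s₁ := by
    rcases hF₁.wt_cast_three (by rw [← hm]; exact hzone1) with e | e
    · exact ⟨(p : ℕ), hpz, e⟩
    · exact ⟨-((p : ℕ) : ZMod 3), neg_ne_zero.mpr hpz, by rw [e]; ring⟩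
  obtain ⟨s₂, hs₂, w2, w12⟩ : ∃ s₂ : ZMod 3, s₂ ≠ 0 ∧ ((wt (flipOn F₂ x) : ℕ) : ZMod 3) = (wt x : ℕ) + s₂ ∧
      ((wt (flipOn F₂ (flipOn F₁ x)) : ℕ) : ZMod 3) = (wt (flipOn F₁ x) : ℕ) + s₂ := by
    have eF : (F₂.filter fun i => i.val < n) = F₂ := Finset.filter_true_of_mem fun i _ => i.isLt
    rcases hF₂'.const with hc | hc
    · have hc' : ∀ i ∈ F₂, flipOn F₁ x i = false := by
        intro i hi
        rw [flipOn_of_not_mem]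
        · exact hc i hi
        · intro hi1; have a1 := (hF₁.inside i hi1).2; have a2 := (hF₂.inside i hi).1; omega
      refine ⟨(p : ℕ), hpz, ?_, ?_⟩
      · rw [Coset21.wt_eq_wtPrefix, Coset21.wt_eq_wtPrefix, wtPrefix_flipOn_false F₂ x hc n, eF, hF₂.card_eq, Nat.cast_add]
      · rw [Coset21.wt_eq_wtPrefix, Coset21.wt_eq_wtPrefix, wtPrefix_flipOn_false F₂ _ hc' n, eF, hF₂.card_eq, Nat.cast_add]
    · have hc' : ∀ i ∈ F₂, flipOn F₁ x i = true := by
        intro i hi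
        rw [flipOn_of_not_mem]
        · exact hc i hi
        · intro hi1; have a1 := (hF₁.inside i hi1).2; have a2 := (hF₂.inside i hi).1; omega
      refine ⟨-((p : ℕ) : ZMod 3), neg_ne_zero.mpr hpz, ?_, ?_⟩
      · have h := wtPrefix_flipOn_true F₂ x hc n
        rw [eF, hF₂.card_eq] at h
        rw [Coset21.wt_eq_wtPrefix, Coset21.wt_eq_wtPrefix, ← h, Nat.cast_add]; ring
      · have h := wtPrefix_flipOn_true F₂ _ hc' n
        rw [eF, hF₂.card_eq] at h
        rw [Coset21.wt_eq_wtPrefix, Coset21.wt_eq_wtPrefix, ← h, Nat.cast_add]; ring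
  have e0 : ((c + wt (flipOn F₁ x) : ℕ) : ZMod 3) = ((c + wt x : ℕ) : ZMod 3) + s₁ := by push_cast; rw [w1]; ring
  have e2' : ((c + wt (flipOn F₂ x) : ℕ) : ZMod 3) = ((c + wt x : ℕ) : ZMod 3) + s₂ := by push_cast; rw [w2]; ring
  have e12 : ((c + wt (flipOn F₂ (flipOn F₁ x)) : ℕ) : ZMod 3) = ((c + wt x : ℕ) : ZMod 3) + s₁ + s₂ := by
    push_cast; rw [w12, w1]; ring
  rw [e0] at t1
  rw [e2'] at t2
  rw [e12] at t12
  have hD0 := eq_zero_of_four_traces _ s₁ s₂ (diff S k x) hs₁ hs₂ t0 t1 t2 t12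
  unfold diff at hD0
  have : ∀ a b : F4, a + b = 0 → b = a := by decide
  exact this _ _ hD0

end RungU

end Summit.QuantumAdvantage.AdviceFreeQNC0.LocalEngine
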